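import Summits.CriticalPhenomena.PercolationContinuityZ3.Theorems.Transplant.FKConnectivityAllQApexConn
import HarnessLib

/-!
# Connectivity correlation inequalities for `φ_{w,q}`, every `q > 0` — the HUB INEQUALITY AT AN APEX, file 1:
# the four LEAF-TYPE CYLINDERS of a degree-2 apex and the TABLE LEMMA (tools for ALR's (13) at apex terminals)

Support file (`--supports stmt-CriticalPhenomena-4575`), census seat `prim-bschramm-census` (gen 22) of the post-continuity
programme; builds on p205010 (kernel theorem, internal audit signed; external expert review pending).  No definitions, no named
facts, no sorries; standard axioms.

SETTING.  `w` any weight vector on a finite vertex type, `u ≠ v`, and `x ∉ {u, v}` an APEX over `(u, v)`: every live pair at `x`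
is `a = s(u,x)` or `b = s(x,v)` (fk-1 g5's hypothesis; the rest of the graph is arbitrary).  Write `w° = w[a↦0][b↦0]`,
`K' = {u ↔ v avoiding a, b}`, `S°(G) = S_{w°}(G)`, `r = q⁻¹`, and the four LEAF-TYPE weights
`N = (1−w a)(1−w b)`, `U = (w a)(1−w b) r`, `V' = (1−w a)(w b) r`, `W = (w a)(w b) r`.
* CYLINDER MASSES (`apex_cyl_cc/oc/co`, with fk-1 g5's `apex_mass_ab_inter` for the open–open cylinder): for `G` insensitive to
  `a, b`: `S_w(a,b closed; G) = N·S°(G)`, `S_w(a open, b closed; G) = U·S°(G)`, `S_w(a closed, b open; G) = V'·S°(G)`,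
  `S_w(a, b open; G) = W·(S°(G) + (r−1)·S°(G ∩ K'ᶜ))` — the type of the leaf `x` is independent of the rest except for ONE
  factor `r` when the leaf is doubly attached and `u ↮ v` otherwise (the leaf then merges two clusters).
* `apex_mass_split`: `S_w(E)` is the sum of its four cylinder pieces; `apex_piece_congr`: a piece only sees `E` on its cylinder;
  **`apex_mass_table`**: hence `S_w(E)` for every event `E` that, on each cylinder, agrees a.s. with an insensitive event
  `Gᵢ ∈ {univ, K', ∅, …}` — the closed form used by files 2–4 (`…ApexHubOne/Two/Three`) for the hub inequality
  (Ayyer–Linusson–Ravichandran (13)) at every triple of terminals among `u, v` and apexes over `(u, v)`, in particular at every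
  triple of every weighted double cone `K_{2,m}`, `K_{1,1,m}`; `reachable_vx_apex_iff` (mirror of fk-1 g5's G2) and
  `real_mul_le_of_mass` (mass form ⇒ measure form) are the remaining tools.
[cite: AyyerLinussonRavichandran2025, §7 eq. (13)–(15), Conj. 7.1 (p. 22)] [cite: Grimmett2006, Thm. (3.1)(a) (p. 37); §1.4 eq. (1.20) (p. 15); §3.9 (p. 63)]
-/

noncomputable section

namespace Summit.CriticalPhenomena.PercolationContinuityZ3.Theorems

namespace FK

open MeasureTheory Set Literature.Probability.LatticeModels Literature.Probability.Percolation
open Literature.Probability.Percolation.DecisionTree (ind ind_of_mem ind_of_not_mem ind_nonneg)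
open Literature.Probability.Percolation.TwoAvoidanceSets (ind_mul_ind)
open scoped Classical symmDiff

variable {V : Type*} [Fintype V]

/-! ### Closed pairs factor out -/

/-- `S_w(J_eᶜ ∩ G) = (1 − w e)·S_{w[e↦0]}(G)` for ANY event `G` (only the deletion corner survives on `J_eᶜ`).
[cite: Grimmett2006, §1.4 eq. (1.20) (p. 15); Thm. (3.1)(a) (p. 37)] -/
theorem sum_rcWeightW_ind_inter_closedPair (w : Sym2 V → unitInterval) (q : ℝ) (e : Sym2 V) (G : Set (BondConfig V)) :
    ∑ ω : BondConfig V, rcWeightW w q ∅ ω * ind ({ω | e ∈ ω}ᶜ ∩ G) ω =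
      (1 - (w e : ℝ)) * ∑ ω : BondConfig V, rcWeightW (Function.update w e 0) q ∅ ω * ind G ω := by
  have h1 : ({ω | e ∈ ω}ᶜ ∩ G : Set (BondConfig V)) = G ∩ {ω | e ∈ ω}ᶜ := Set.inter_comm _ _
  have h2 : (G ∩ {ω | e ∈ ω} : Set (BondConfig V)) = {ω | e ∈ ω} ∩ G := Set.inter_comm _ _
  rw [h1, sum_rcWeightW_ind_inter_compl w q G {ω | e ∈ ω}, h2, sum_rcWeightW_ind_inter_openPair w q e G,
    sum_rcWeightW_ind_affine w q e G]
  ring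

/-- **Pendant pair at `a = s(u,x)` with `b = s(x,v)` dead** (mirror of fk-1 g5's `sum_pendant_openPair`): for `E` insensitive to
`a`, `S_w(J_a ∩ E) = (w a)·q⁻¹·S_{w[a↦0]}(E)`. [cite: Grimmett2006, Thm. (3.1)(a) (p. 37)] -/
theorem sum_pendant_openPair_left (w : Sym2 V → unitInterval) {q : ℝ} (hq : q ≠ 0) {u v x : V} (hxu : x ≠ u) (hxv : x ≠ v)
    (huv : u ≠ v) (hw : ∀ e : Sym2 V, x ∈ e → ((w e : unitInterval) : ℝ) ≠ 0 → u ∈ e ∨ v ∈ e)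
    (hb : ((w s(x, v) : unitInterval) : ℝ) = 0) (E : Set (BondConfig V))
    (hE : ∀ ω : BondConfig V, ω ∆ {s(u, x)} ∈ E ↔ ω ∈ E) :
    ∑ ω : BondConfig V, rcWeightW w q ∅ ω * ind ({ω | s(u, x) ∈ ω} ∩ E) ω =
      ((w s(u, x) : unitInterval) : ℝ) * q⁻¹ * ∑ ω : BondConfig V, rcWeightW (Function.update w s(u, x) 0) q ∅ ω * ind E ω := by
  have hw' : ∀ e : Sym2 V, x ∈ e → ((w e : unitInterval) : ℝ) ≠ 0 → v ∈ e ∨ u ∈ e :=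
    fun e hxe hne => (hw e hxe hne).symm
  have hb' : ((w s(v, x) : unitInterval) : ℝ) = 0 := by rw [Sym2.eq_swap]; exact hb
  have hE' : ∀ ω : BondConfig V, ω ∆ {s(x, u)} ∈ E ↔ ω ∈ E := by rw [Sym2.eq_swap]; exact hE
  have h := sum_pendant_openPair w hq hxv hxu huv.symm hw' hb' E hE'
  rw [show s(x, u) = s(u, x) from Sym2.eq_swap] at h
  exact h

/-! ### The four leaf-type cylinders of an apex -/

/-- **Closed–closed cylinder**: `S_w(J_aᶜ ∩ J_bᶜ ∩ G) = (1 − w a)(1 − w b)·S_{w°}(G)` for ANY `G` (`a ≠ b`).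
[cite: Grimmett2006, §1.4 eq. (1.20) (p. 15)] -/
theorem apex_cyl_cc (w : Sym2 V → unitInterval) (q : ℝ) {u v x : V} (hxu : x ≠ u) (huv : u ≠ v) (G : Set (BondConfig V)) :
    ∑ ω : BondConfig V, rcWeightW w q ∅ ω * ind ({ω | s(u, x) ∈ ω}ᶜ ∩ ({ω | s(x, v) ∈ ω}ᶜ ∩ G)) ω =
      (1 - ((w s(u, x) : unitInterval) : ℝ)) * (1 - ((w s(x, v) : unitInterval) : ℝ)) *
        ∑ ω : BondConfig V, rcWeightW (Function.update (Function.update w s(u, x) 0) s(x, v) 0) q ∅ ω * ind G ω := by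
  have hab := apex_pairs_ne hxu huv
  rw [sum_rcWeightW_ind_inter_closedPair w q s(u, x), sum_rcWeightW_ind_inter_closedPair _ q s(x, v),
    Function.update_of_ne hab.symm]
  ring

/-- **Open–closed cylinder**: `S_w(J_a ∩ J_bᶜ ∩ G) = (w a)(1 − w b)·q⁻¹·S_{w°}(G)` for `G` insensitive to `a`
(with `b` deleted, `x` is pendant at `u`). [cite: Grimmett2006, Thm. (3.1)(a) (p. 37)] -/
theorem apex_cyl_oc (w : Sym2 V → unitInterval) {q : ℝ} (hq : q ≠ 0) {u v x : V} (hxu : x ≠ u) (hxv : x ≠ v)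
    (huv : u ≠ v) (hw : ∀ e : Sym2 V, x ∈ e → ((w e : unitInterval) : ℝ) ≠ 0 → u ∈ e ∨ v ∈ e)
    (G : Set (BondConfig V)) (hGa : ∀ ω : BondConfig V, ω ∆ {s(u, x)} ∈ G ↔ ω ∈ G) :
    ∑ ω : BondConfig V, rcWeightW w q ∅ ω * ind ({ω | s(x, v) ∈ ω}ᶜ ∩ ({ω | s(u, x) ∈ ω} ∩ G)) ω =
      ((w s(u, x) : unitInterval) : ℝ) * (1 - ((w s(x, v) : unitInterval) : ℝ)) * q⁻¹ *
        ∑ ω : BondConfig V, rcWeightW (Function.update (Function.update w s(u, x) 0) s(x, v) 0) q ∅ ω * ind G ω := by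
  have hab := apex_pairs_ne hxu huv
  have hwb := apex_hyp_update hw s(x, v) (fun _ => Or.inr (Sym2.mem_mk_right x v)) 0
  have hb0 : ((Function.update w s(x, v) 0 s(x, v) : unitInterval) : ℝ) = 0 := by simp
  rw [sum_rcWeightW_ind_inter_closedPair w q s(x, v), sum_pendant_openPair_left _ hq hxu hxv huv hwb hb0 G hGa,
    Function.update_of_ne hab, Function.update_comm hab.symm]
  ring

/-- **Closed–open cylinder**: `S_w(J_aᶜ ∩ J_b ∩ G) = (1 − w a)(w b)·q⁻¹·S_{w°}(G)` for `G` insensitive to `b`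
(with `a` deleted, `x` is pendant at `v`). [cite: Grimmett2006, Thm. (3.1)(a) (p. 37)] -/
theorem apex_cyl_co (w : Sym2 V → unitInterval) {q : ℝ} (hq : q ≠ 0) {u v x : V} (hxu : x ≠ u) (hxv : x ≠ v)
    (huv : u ≠ v) (hw : ∀ e : Sym2 V, x ∈ e → ((w e : unitInterval) : ℝ) ≠ 0 → u ∈ e ∨ v ∈ e)
    (G : Set (BondConfig V)) (hGb : ∀ ω : BondConfig V, ω ∆ {s(x, v)} ∈ G ↔ ω ∈ G) :
    ∑ ω : BondConfig V, rcWeightW w q ∅ ω * ind ({ω | s(u, x) ∈ ω}ᶜ ∩ ({ω | s(x, v) ∈ ω} ∩ G)) ω =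
      (1 - ((w s(u, x) : unitInterval) : ℝ)) * ((w s(x, v) : unitInterval) : ℝ) * q⁻¹ *
        ∑ ω : BondConfig V, rcWeightW (Function.update (Function.update w s(u, x) 0) s(x, v) 0) q ∅ ω * ind G ω := by
  have hab := apex_pairs_ne hxu huv
  have hwa := apex_hyp_update hw s(u, x) (fun _ => Or.inl (Sym2.mem_mk_left u x)) 0
  have ha0 : ((Function.update w s(u, x) 0 s(u, x) : unitInterval) : ℝ) = 0 := by simp
  rw [sum_rcWeightW_ind_inter_closedPair w q s(u, x), sum_pendant_openPair _ hq hxu hxv huv hwa ha0 G hGb,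
    Function.update_of_ne hab.symm]
  ring

/-- **Open–open cylinder** (fk-1 g5's apex identity 3, regrouped): `S_w(J_a ∩ J_b ∩ G) = (w a)(w b)q⁻¹·(S°(G) + (q⁻¹−1)·S°(G ∩ K'ᶜ))`
for `G` insensitive to `a, b` — the doubly attached leaf merges the clusters of `u` and `v` when they are distinct.
[cite: Grimmett2006, Thm. (3.1)(a) (p. 37); §1.4 eq. (1.20) (p. 15)] -/
theorem apex_cyl_oo (w : Sym2 V → unitInterval) {q : ℝ} (hq : q ≠ 0) {u v x : V} (hxu : x ≠ u) (hxv : x ≠ v)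
    (huv : u ≠ v) (hw : ∀ e : Sym2 V, x ∈ e → ((w e : unitInterval) : ℝ) ≠ 0 → u ∈ e ∨ v ∈ e)
    (G : Set (BondConfig V)) (hGa : ∀ ω : BondConfig V, ω ∆ {s(u, x)} ∈ G ↔ ω ∈ G)
    (hGb : ∀ ω : BondConfig V, ω ∆ {s(x, v)} ∈ G ↔ ω ∈ G) :
    ∑ ω : BondConfig V, rcWeightW w q ∅ ω * ind ({ω | s(u, x) ∈ ω} ∩ ({ω | s(x, v) ∈ ω} ∩ G)) ω =
      ((w s(u, x) : unitInterval) : ℝ) * ((w s(x, v) : unitInterval) : ℝ) * q⁻¹ *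
        (∑ ω : BondConfig V, rcWeightW (Function.update (Function.update w s(u, x) 0) s(x, v) 0) q ∅ ω * ind G ω +
          (q⁻¹ - 1) * ∑ ω : BondConfig V, rcWeightW (Function.update (Function.update w s(u, x) 0) s(x, v) 0) q ∅ ω *
            ind (G ∩ {ω : BondConfig V | ω \ {s(u, x), s(x, v)} ∈ (openConn u v : Set (BondConfig V))}ᶜ) ω) := by
  rw [apex_mass_ab_inter w hq hxu hxv huv hw G hGa hGb]
  ring

/-! ### Splitting a mass over the four cylinders, and replacing the event on each cylinder -/

/-- `S_w(E)` is the sum of its four leaf-type cylinder pieces (any two pairs `a, b`). [folklore] -/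
theorem apex_mass_split (w : Sym2 V → unitInterval) (q : ℝ) (a b : Sym2 V) (E : Set (BondConfig V)) :
    ∑ ω : BondConfig V, rcWeightW w q ∅ ω * ind E ω =
      ∑ ω : BondConfig V, rcWeightW w q ∅ ω * ind ({ω | a ∈ ω} ∩ ({ω | b ∈ ω} ∩ E)) ω +
        ∑ ω : BondConfig V, rcWeightW w q ∅ ω * ind ({ω | b ∈ ω}ᶜ ∩ ({ω | a ∈ ω} ∩ E)) ω +
        ∑ ω : BondConfig V, rcWeightW w q ∅ ω * ind ({ω | a ∈ ω}ᶜ ∩ ({ω | b ∈ ω} ∩ E)) ω +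
        ∑ ω : BondConfig V, rcWeightW w q ∅ ω * ind ({ω | a ∈ ω}ᶜ ∩ ({ω | b ∈ ω}ᶜ ∩ E)) ω := by
  rw [← Finset.sum_add_distrib, ← Finset.sum_add_distrib, ← Finset.sum_add_distrib]
  refine Finset.sum_congr rfl fun ω _ => ?_
  rw [← ind_mul_ind, ← ind_mul_ind, ← ind_mul_ind, ← ind_mul_ind, ← ind_mul_ind, ← ind_mul_ind, ← ind_mul_ind,
    ← ind_mul_ind]
  by_cases ha : ω ∈ ({ω | a ∈ ω} : Set (BondConfig V)) <;> by_cases hb : ω ∈ ({ω | b ∈ ω} : Set (BondConfig V))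
  · have hac : ω ∉ ({ω | a ∈ ω}ᶜ : Set (BondConfig V)) := fun h => h ha
    have hbc : ω ∉ ({ω | b ∈ ω}ᶜ : Set (BondConfig V)) := fun h => h hb
    rw [ind_of_mem ha, ind_of_mem hb, ind_of_not_mem hac, ind_of_not_mem hbc]; ring
  · have hac : ω ∉ ({ω | a ∈ ω}ᶜ : Set (BondConfig V)) := fun h => h ha
    have hbc : ω ∈ ({ω | b ∈ ω}ᶜ : Set (BondConfig V)) := hb
    rw [ind_of_mem ha, ind_of_not_mem hb, ind_of_not_mem hac, ind_of_mem hbc]; ring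
  · have hac : ω ∈ ({ω | a ∈ ω}ᶜ : Set (BondConfig V)) := ha
    have hbc : ω ∉ ({ω | b ∈ ω}ᶜ : Set (BondConfig V)) := fun h => h hb
    rw [ind_of_not_mem ha, ind_of_mem hb, ind_of_mem hac, ind_of_not_mem hbc]; ring
  · have hac : ω ∈ ({ω | a ∈ ω}ᶜ : Set (BondConfig V)) := ha
    have hbc : ω ∈ ({ω | b ∈ ω}ᶜ : Set (BondConfig V)) := hb
    rw [ind_of_not_mem ha, ind_of_not_mem hb, ind_of_mem hac, ind_of_mem hbc]; ring

/-- Replacing the event on a cylinder: if `E` and `G` agree almost surely on `P ∩ Q`, the pieces `S_w(P ∩ Q ∩ E)` and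
`S_w(P ∩ Q ∩ G)` agree. [cite: Grimmett2006, §1.4 eq. (1.20) (p. 15)] -/
theorem apex_piece_congr (w : Sym2 V → unitInterval) (q : ℝ) {P Q E G : Set (BondConfig V)}
    (h : ∀ ω, rcWeightW w q ∅ ω ≠ 0 → ω ∈ P → ω ∈ Q → (ω ∈ E ↔ ω ∈ G)) :
    ∑ ω : BondConfig V, rcWeightW w q ∅ ω * ind (P ∩ (Q ∩ E)) ω =
      ∑ ω : BondConfig V, rcWeightW w q ∅ ω * ind (P ∩ (Q ∩ G)) ω := by
  refine sum_rcWeightW_ind_congr_ae w q fun ω hω => ?_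
  simp only [Set.mem_inter_iff]
  constructor
  · rintro ⟨hP, hQ, hE⟩; exact ⟨hP, hQ, (h ω hω hP hQ).1 hE⟩
  · rintro ⟨hP, hQ, hG⟩; exact ⟨hP, hQ, (h ω hω hP hQ).2 hG⟩

/-! ### Reachability of the apex from `v` (mirror of fk-1 g5's `reachable_ux_apex_iff`) -/

omit [Fintype V] in
/-- **Apex lemma G2'**: if the open pairs at `x` lie in `{ux, xv}`, then `v ↔ x` iff `xv` is open, or `ux` is open and `u ↔ v`
avoiding the apex pairs. [folklore] -/
theorem reachable_vx_apex_iff {ω : BondConfig V} {u v x : V} (hxu : x ≠ u) (hxv : x ≠ v)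
    (hω : ∀ e ∈ ω, x ∈ e → e = s(u, x) ∨ e = s(x, v)) :
    (openGraph ω).Reachable v x ↔
      s(x, v) ∈ ω ∨ (s(u, x) ∈ ω ∧ (openGraph (ω \ {s(u, x), s(x, v)})).Reachable u v) := by
  have hω' : ∀ e ∈ ω, x ∈ e → e = s(v, x) ∨ e = s(x, u) := by
    intro e he hxe
    rcases hω e he hxe with h | h
    · right; rw [h, Sym2.eq_swap]
    · left; rw [h, Sym2.eq_swap]
  have h := reachable_ux_apex_iff (u := v) (v := u) hxv hxu hω'
  have hset : (ω \ {s(v, x), s(x, u)} : Set (Sym2 V)) = ω \ {s(u, x), s(x, v)} := by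
    rw [show s(v, x) = s(x, v) from Sym2.eq_swap, show s(x, u) = s(u, x) from Sym2.eq_swap, Set.pair_comm]
  rw [hset, show s(v, x) = s(x, v) from Sym2.eq_swap, show s(x, u) = s(u, x) from Sym2.eq_swap] at h
  rw [h]
  constructor
  · rintro (hb | ⟨ha, hr⟩)
    · exact Or.inl hb
    · exact Or.inr ⟨ha, hr.symm⟩
  · rintro (hb | ⟨ha, hr⟩)
    · exact Or.inl hb
    · exact Or.inr ⟨ha, hr.symm⟩

/-! ### From a mass inequality to the measure statement -/

/-- `S(A)·S(B) ≤ Z·S(A ∩ B)` gives `μ(A)μ(B) ≤ μ(Ω)μ(A ∩ B)` for `μ = φ_{w,q}`, `q > 0`. [cite: Grimmett2006, §1.4 eq. (1.20) (p. 15)] -/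
theorem real_mul_le_of_mass (w : Sym2 V → unitInterval) {q : ℝ} (hq : 0 < q) (A B : Set (BondConfig V))
    (h : (∑ ω : BondConfig V, rcWeightW w q ∅ ω * ind A ω) * (∑ ω : BondConfig V, rcWeightW w q ∅ ω * ind B ω) ≤
      rcPartitionFunctionW w q ∅ * ∑ ω : BondConfig V, rcWeightW w q ∅ ω * ind (A ∩ B) ω) :
    (rcMeasureW w q ∅).real A * (rcMeasureW w q ∅).real B ≤
      (rcMeasureW w q ∅).real univ * (rcMeasureW w q ∅).real (A ∩ B) := by
  haveI := isProbabilityMeasure_rcMeasureW w hq (∅ : Set V)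
  rw [probReal_univ, one_mul, rcMeasureW_real_eq_sum_div w hq ∅ A, rcMeasureW_real_eq_sum_div w hq ∅ B,
    rcMeasureW_real_eq_sum_div w hq ∅ (A ∩ B)]
  have hZ := rcPartitionFunctionW_pos w hq (∅ : Set V)
  rw [div_mul_div_comm, div_le_div_iff₀ (mul_pos hZ hZ) hZ]
  calc (∑ ω : BondConfig V, rcWeightW w q ∅ ω * ind A ω) * (∑ ω : BondConfig V, rcWeightW w q ∅ ω * ind B ω) *
          rcPartitionFunctionW w q ∅
      ≤ (rcPartitionFunctionW w q ∅ * ∑ ω : BondConfig V, rcWeightW w q ∅ ω * ind (A ∩ B) ω) *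
          rcPartitionFunctionW w q ∅ := mul_le_mul_of_nonneg_right h hZ.le
    _ = (∑ ω : BondConfig V, rcWeightW w q ∅ ω * ind (A ∩ B) ω) *
          (rcPartitionFunctionW w q ∅ * rcPartitionFunctionW w q ∅) := by ring


/-- The mass of the empty event vanishes. [folklore] -/
theorem sum_rcWeightW_ind_empty (w : Sym2 V → unitInterval) (q : ℝ) :
    ∑ ω : BondConfig V, rcWeightW w q ∅ ω * ind (∅ : Set (BondConfig V)) ω = 0 :=
  Finset.sum_eq_zero fun ω _ => by rw [ind_of_not_mem (Set.notMem_empty ω), mul_zero]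

/-! ### The table lemma: the mass of an event from its behaviour on the four cylinders -/

/-- **Table lemma.**  If on each leaf-type cylinder of the apex `x` the event `E` agrees almost surely with an event `Gᵢ`
insensitive to the relevant apex pairs, then
`S_w(E) = (w a)(w b)q⁻¹·(S°(G₁) + (q⁻¹−1)S°(G₁ ∩ K'ᶜ)) + (w a)(1 − w b)q⁻¹·S°(G₂) + (1 − w a)(w b)q⁻¹·S°(G₃) + (1 − w a)(1 − w b)·S°(G₄)`.
[cite: Grimmett2006, Thm. (3.1)(a) (p. 37); §1.4 eq. (1.20) (p. 15)] -/
theorem apex_mass_table (w : Sym2 V → unitInterval) {q : ℝ} (hq : q ≠ 0) {u v x : V} (hxu : x ≠ u) (hxv : x ≠ v)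
    (huv : u ≠ v) (hw : ∀ e : Sym2 V, x ∈ e → ((w e : unitInterval) : ℝ) ≠ 0 → u ∈ e ∨ v ∈ e)
    (E G₁ G₂ G₃ G₄ : Set (BondConfig V))
    (h₁ : ∀ ω, rcWeightW w q ∅ ω ≠ 0 → s(u, x) ∈ ω → s(x, v) ∈ ω → (ω ∈ E ↔ ω ∈ G₁))
    (h₂ : ∀ ω, rcWeightW w q ∅ ω ≠ 0 → s(x, v) ∉ ω → s(u, x) ∈ ω → (ω ∈ E ↔ ω ∈ G₂))
    (h₃ : ∀ ω, rcWeightW w q ∅ ω ≠ 0 → s(u, x) ∉ ω → s(x, v) ∈ ω → (ω ∈ E ↔ ω ∈ G₃))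
    (h₄ : ∀ ω, rcWeightW w q ∅ ω ≠ 0 → s(u, x) ∉ ω → s(x, v) ∉ ω → (ω ∈ E ↔ ω ∈ G₄))
    (hG₁a : ∀ ω : BondConfig V, ω ∆ {s(u, x)} ∈ G₁ ↔ ω ∈ G₁) (hG₁b : ∀ ω : BondConfig V, ω ∆ {s(x, v)} ∈ G₁ ↔ ω ∈ G₁)
    (hG₂a : ∀ ω : BondConfig V, ω ∆ {s(u, x)} ∈ G₂ ↔ ω ∈ G₂) (hG₃b : ∀ ω : BondConfig V, ω ∆ {s(x, v)} ∈ G₃ ↔ ω ∈ G₃) :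
    ∑ ω : BondConfig V, rcWeightW w q ∅ ω * ind E ω =
      ((w s(u, x) : unitInterval) : ℝ) * ((w s(x, v) : unitInterval) : ℝ) * q⁻¹ *
          (∑ ω : BondConfig V, rcWeightW (Function.update (Function.update w s(u, x) 0) s(x, v) 0) q ∅ ω * ind G₁ ω +
            (q⁻¹ - 1) * ∑ ω : BondConfig V, rcWeightW (Function.update (Function.update w s(u, x) 0) s(x, v) 0) q ∅ ω *
              ind (G₁ ∩ {ω : BondConfig V | ω \ {s(u, x), s(x, v)} ∈ (openConn u v : Set (BondConfig V))}ᶜ) ω) +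
        ((w s(u, x) : unitInterval) : ℝ) * (1 - ((w s(x, v) : unitInterval) : ℝ)) * q⁻¹ *
          ∑ ω : BondConfig V, rcWeightW (Function.update (Function.update w s(u, x) 0) s(x, v) 0) q ∅ ω * ind G₂ ω +
        (1 - ((w s(u, x) : unitInterval) : ℝ)) * ((w s(x, v) : unitInterval) : ℝ) * q⁻¹ *
          ∑ ω : BondConfig V, rcWeightW (Function.update (Function.update w s(u, x) 0) s(x, v) 0) q ∅ ω * ind G₃ ω +
        (1 - ((w s(u, x) : unitInterval) : ℝ)) * (1 - ((w s(x, v) : unitInterval) : ℝ)) *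
          ∑ ω : BondConfig V, rcWeightW (Function.update (Function.update w s(u, x) 0) s(x, v) 0) q ∅ ω * ind G₄ ω := by
  have e₁ : ∑ ω : BondConfig V, rcWeightW w q ∅ ω * ind ({ω | s(u, x) ∈ ω} ∩ ({ω | s(x, v) ∈ ω} ∩ E)) ω =
      ∑ ω : BondConfig V, rcWeightW w q ∅ ω * ind ({ω | s(u, x) ∈ ω} ∩ ({ω | s(x, v) ∈ ω} ∩ G₁)) ω :=
    apex_piece_congr w q fun ω hω hP hQ => h₁ ω hω hP hQ
  have e₂ : ∑ ω : BondConfig V, rcWeightW w q ∅ ω * ind ({ω | s(x, v) ∈ ω}ᶜ ∩ ({ω | s(u, x) ∈ ω} ∩ E)) ω =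
      ∑ ω : BondConfig V, rcWeightW w q ∅ ω * ind ({ω | s(x, v) ∈ ω}ᶜ ∩ ({ω | s(u, x) ∈ ω} ∩ G₂)) ω :=
    apex_piece_congr w q fun ω hω hP hQ => h₂ ω hω hP hQ
  have e₃ : ∑ ω : BondConfig V, rcWeightW w q ∅ ω * ind ({ω | s(u, x) ∈ ω}ᶜ ∩ ({ω | s(x, v) ∈ ω} ∩ E)) ω =
      ∑ ω : BondConfig V, rcWeightW w q ∅ ω * ind ({ω | s(u, x) ∈ ω}ᶜ ∩ ({ω | s(x, v) ∈ ω} ∩ G₃)) ω :=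
    apex_piece_congr w q fun ω hω hP hQ => h₃ ω hω hP hQ
  have e₄ : ∑ ω : BondConfig V, rcWeightW w q ∅ ω * ind ({ω | s(u, x) ∈ ω}ᶜ ∩ ({ω | s(x, v) ∈ ω}ᶜ ∩ E)) ω =
      ∑ ω : BondConfig V, rcWeightW w q ∅ ω * ind ({ω | s(u, x) ∈ ω}ᶜ ∩ ({ω | s(x, v) ∈ ω}ᶜ ∩ G₄)) ω :=
    apex_piece_congr w q fun ω hω hP hQ => h₄ ω hω hP hQ
  rw [apex_mass_split w q s(u, x) s(x, v) E, e₁, e₂, e₃, e₄, apex_cyl_oo w hq hxu hxv huv hw G₁ hG₁a hG₁b,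
    apex_cyl_oc w hq hxu hxv huv hw G₂ hG₂a, apex_cyl_co w hq hxu hxv huv hw G₃ hG₃b, apex_cyl_cc w q hxu huv G₄]

/-- The base masses: `S°(univ) = S°(K') + S°(K'ᶜ)`. [cite: Grimmett2006, §1.4 eq. (1.20) (p. 15)] -/
theorem sum_rcWeightW_ind_univ_eq_add (w : Sym2 V → unitInterval) (q : ℝ) (K : Set (BondConfig V)) :
    ∑ ω : BondConfig V, rcWeightW w q ∅ ω * ind (Set.univ : Set (BondConfig V)) ω =
      ∑ ω : BondConfig V, rcWeightW w q ∅ ω * ind K ω + ∑ ω : BondConfig V, rcWeightW w q ∅ ω * ind Kᶜ ω := by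
  rw [sum_rcWeightW_ind_univ, sum_rcWeightW_ind_compl]; ring


end FK

end Summit.CriticalPhenomena.PercolationContinuityZ3.Theorems

end
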